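import Literature.AlgebraicGeometry.Motives.HodgeSheavesProofs
import Literature.AlgebraicGeometry.Modules.FrameTransition
import Mathlib.LinearAlgebra.ExteriorPower.Basis
import HarnessLib

/-!
# Hodge sheaves of a scheme with globally free cotangent sheaf: `Ω¹ ≅ 𝒪^d ⇒ Ωᵃ ≅ 𝒪^{C(d,a)}`

For a scheme `X` and an `𝒪_X`-module `E` with a GLOBAL trivialisation `E ≅ 𝒪_X^I` (`I` finite;
Mathlib's `SheafOfModules.free I`), every exterior power `⋀ⁿ E`
(`Literature.AlgebraicGeometry.Motives.exteriorPowerSheaf`, `Motives/HodgeSheaves.lean`: the sheaf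
associated to `U ↦ ⋀ⁿ_{𝒪(U)} Γ(U, E)`) is globally free on the `n`-element subsets of `I`:

* `exists_basis_eq_map_basisSection`, `exists_basis_sections_of_iso_free` — the sections
  `Γ(E, V)` of a trivialised module are free over `Γ(X, V)` on the (restricted) basis sections of
  the frame (the frame calculus `basisSection` / `coord` of `Modules/SheafHomExact.lean`,
  `Modules/LocalFrames.lean`, `Modules/FrameTransition.lean`, packaged as Mathlib `Module.Basis`),
  compatibly with restriction;
* `nonempty_exteriorPowerPresheaf_iso_of_basis` — hence the PRESHEAF `U ↦ ⋀ⁿ Γ(U, E)` is already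
  isomorphic to (the presheaf underlying) `𝒪_X^J`, `J ≃ {S ⊆ I, #S = n}`, on the wedge bases
  `b_S = ∧_{i ∈ S} b_i` (Mathlib `Basis.exteriorPower`);
* `nonempty_exteriorPowerSheaf_iso_free_of_equiv` / `_of_card` — sheafifying,
  **`⋀ⁿ E ≅ 𝒪_X^J`** whenever `#J = C(#I, n)` (Hartshorne II Ex. 5.16 (a), "`ℱ` locally free of
  rank `n` ⇒ `⋀ʳ ℱ` locally free of rank `C(n, r)`", in the globally free case, where no
  localisation is needed); `isFiniteLocallyFree_of_iso_free`, `exists_isLocallyFreeData_of_iso_free`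
  (a globally free module of finite rank is a vector bundle of constant rank `#I`);
* for a `k`-scheme `X : Over (Spec k)` with `Ω¹_{X/k} ≅ 𝒪_X^I` (`Motives.cotangentSheaf`):
  **`nonempty_free_iso_hodgeSheaf_of_cotangentSheaf_free`** — `𝒪_X^{(a-subsets of I)} ≅ Ωᵃ_{X/k}`
  (`Motives.hodgeSheaf X a = ⋀ᵃ Ω¹`), its cardinality / `Fin (d.choose a)`-indexed forms
  (`nonempty_hodgeSheaf_iso_free_of_card`, `nonempty_hodgeSheaf_iso_free_fin`,
  `nonempty_free_fin_iso_hodgeSheaf_of_cotangentSheaf_free`), the underlying abelian sheaves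
  (`nonempty_toSheaf_hodgeSheaf_iso_of_card`), and the vector-bundle consequences
  (`isFiniteLocallyFree_hodgeSheaf_of_cotangentSheaf_free`,
  `exists_isLocallyFreeData_hodgeSheaf_of_cotangentSheaf_free`, the shape of
  `Motives.hasRank_hodgeSheaf_choose` WITHOUT smoothness).

Why: on the "`Ω¹` free" branch of the `p`-adic lifting argument for algebraic classes (abelian
schemes `𝒳/W(k)`, where `Ω¹_{𝒳/W} ≅ 𝒪^g` on the invariant differentials) all Hodge sheaves are free,
so `Hᵇ(𝒳, Ωᵃ) ≅ Hᵇ(𝒳, 𝒪)^{C(d,a)}` inherits `p`-torsion-freeness from `Hᵇ(𝒳, 𝒪)` — the input of the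
lattice lemmas behind Bloch–Esnault–Kerz, *p-adic deformation of algebraic cycle classes* (2014),
Rem. 35 (2) of the arXiv version, on that branch. Everything here is proved; no named facts.

Not here: the cohomological consequences (`Hᵇ` of a finite direct sum of copies of `𝒪`), which are
pure homological algebra on `SheafOfModules.toSheaf` of a free module; the locally free case
(`Motives.hasRank_hodgeSheaf_choose_holds`, `Motives/HodgeSheavesProofs.lean`).

## References

* R. Hartshorne, *Algebraic Geometry*, GTM 52, Springer (1977): II.5 (free and locally free
  sheaves), II Ex. 5.16 (a) (`⋀ʳ` of a locally free sheaf of rank `n` is locally free of rank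
  `C(n, r)`), III.7 (`Ωᵖ = ⋀ᵖ Ω`). [Hartshorne1977]
-/

open CategoryTheory CategoryTheory.Limits AlgebraicGeometry Opposite TopologicalSpace

universe u

namespace Literature.AlgebraicGeometry.Motives

open Literature.AlgebraicGeometry.Modules

/-! ### Global frames: the sections of a globally free module of finite rank -/

section Frames

-- `TopCat.Presheaf`/`TopCat.Sheaf` are not reducible: as in Mathlib's `AlgebraicGeometry.Modules`.
set_option backward.isDefEq.respectTransparency false

variable {Y : Scheme.{u}}

/-- **Restriction of a free module is free**: `𝒪_X^I|_U ≅ 𝒪_U^I` on the site of opens over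
`U` (the restriction functor `M ↦ M.over U` is a left adjoint, so it preserves the coproduct
`free I = ∐_I 𝒪`, and it sends `𝒪_X` to `𝒪_U`; Mathlib's `SheafOfModules.mapFreeIso`).
[folklore] -/
theorem nonempty_free_iso_free_over (U : Y.Opens) (I : Type u) :
    Nonempty (SheafOfModules.free I ≅
      (SheafOfModules.free (R := Y.ringCatSheaf) I).over U) :=
  haveI : (SheafOfModules.overFunctor Y.ringCatSheaf U).IsLeftAdjoint :=
    inferInstanceAs (SheafOfModules.pushforward _).IsLeftAdjoint
  ⟨SheafOfModules.mapFreeIso (SheafOfModules.overFunctor Y.ringCatSheaf U) I (Iso.refl _)⟩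

/-- A global trivialisation `E ≅ 𝒪_X^I` restricts to a trivialisation `𝒪^I ≅ E|_U` over every
open `U` (a "frame" in the sense of `Modules/SheafHomExact`, `Modules/LocalFrames`).
[folklore] -/
theorem nonempty_free_iso_over_of_iso_free {E : Y.Modules} {I : Type u}
    (e : E ≅ SheafOfModules.free I) (U : Y.Opens) :
    Nonempty (SheafOfModules.free I ≅ E.over U) := by
  obtain ⟨e₀⟩ := nonempty_free_iso_free_over (Y := Y) U I
  exact ⟨e₀ ≪≫ (SheafOfModules.overFunctor Y.ringCatSheaf U).mapIso e.symm⟩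

variable {E : Y.Modules} {W V : Y.Opens} {I : Type u}

/-- **Sections of a trivialised module are free on the basis sections**: for a frame
`e : 𝒪^I ≅ E|_W` (`I` finite) and `V ≤ W`, the restricted basis sections `b_i|_V` form a basis
of `Γ(E, V)` over `Γ(X, V)` — every section is `∑_i λ_i(s) b_i|_V` (`eq_sum_coord_smul`) with
unique coordinates (`coord_sum_smul_basisSection`). (Hartshorne, *Algebraic Geometry*, II.5:
`Γ(V, 𝒪^n) = Γ(V, 𝒪)^n`.) [folklore] -/
theorem exists_basis_eq_map_basisSection [Fintype I] (e : SheafOfModules.free I ≅ E.over W)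
    (k : V ⟶ W) :
    ∃ b : Module.Basis I Γ(Y, V) Γ(E, V),
      ∀ i, b i = E.presheaf.map k.op (basisSection e i) := by
  classical
  let f : Γ(E, V) ≃ₗ[Γ(Y, V)] (I → Γ(Y, V)) :=
    { toFun := fun s i => coord e k s i
      map_add' := fun s t => funext fun i => coord_add e k s t i
      map_smul' := fun r s => funext fun i => coord_smul e k r s i
      invFun := fun c => ∑ i, c i • E.presheaf.map k.op (basisSection e i)
      left_inv := fun s => (eq_sum_coord_smul e k s).symm
      right_inv := fun c => funext fun j => coord_sum_smul_basisSection e k c j }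
  refine ⟨Module.Basis.ofEquivFun f, fun i => ?_⟩
  rw [Module.Basis.coe_ofEquivFun]
  change ∑ j, (Pi.single i (1 : Γ(Y, V)) : I → Γ(Y, V)) j •
    E.presheaf.map k.op (basisSection e j) = _
  simp_rw [Pi.single_apply, ite_smul, one_smul, zero_smul, Finset.sum_ite_eq', Finset.mem_univ,
    if_true]

/-- **Global frames give compatible bases of all modules of sections**: if `E ≅ 𝒪_X^I` (`I`
finite), there are bases `b_V` of `Γ(E, V)` over `Γ(X, V)` for all opens `V` (the restrictions
of the global basis sections) compatible with the restriction maps. [folklore] -/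
theorem exists_basis_sections_of_iso_free [Finite I] (e : E ≅ SheafOfModules.free I) :
    ∃ b : ∀ V : Y.Opens, Module.Basis I Γ(Y, V) Γ(E, V),
      ∀ ⦃V V' : Y.Opens⦄ (l : V' ⟶ V) (i : I), E.presheaf.map l.op (b V i) = b V' i := by
  cases nonempty_fintype I
  obtain ⟨e₀⟩ := nonempty_free_iso_over_of_iso_free e ⊤
  choose b hb using fun V : Y.Opens =>
    exists_basis_eq_map_basisSection e₀ (homOfLE (le_top : V ≤ ⊤))
  refine ⟨b, fun V V' l i => ?_⟩
  rw [hb, hb, ← ConcreteCategory.comp_apply, ← Functor.map_comp]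
  rfl

/-- A globally free module of finite rank is finite locally free
(`Motives.IsFiniteLocallyFree`: the global frame restricted to the one-member cover `{X}`).
[folklore] -/
theorem isFiniteLocallyFree_of_iso_free [Finite I] (e : E ≅ SheafOfModules.free I) :
    IsFiniteLocallyFree E :=
  fun _ => ⟨⊤, trivial, I, ‹Finite I›, nonempty_free_iso_over_of_iso_free e ⊤⟩

-- the sheafification instances on the over-sites `Opens Y / U` behind `LocalGeneratorsData`
-- (`HasWeakSheafify`, `WEqualsLocallyBijective`) sit at the default synthesis budget's edge here
set_option synthInstance.maxHeartbeats 160000 in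
/-- A globally free module `E ≅ 𝒪_X^I` of finite rank has constant rank `#I` in the sense of
`Motives.HasRank` (`Motives/CrystallineRealization`, unfolded here to keep the import graph low):
local generators data over the one-member cover `{X}` which are locally free data (Mathlib's
`IsLocallyFreeData`: the tautological sections of `𝒪^I` pushed along the frame) with `#I`
generators. [folklore] -/
theorem exists_isLocallyFreeData_of_iso_free [Finite I] (e : E ≅ SheafOfModules.free I) :
    ∃ q : SheafOfModules.LocalGeneratorsData.{u} (R := Y.ringCatSheaf) E,
      q.IsLocallyFreeData ∧
        ∀ i, Finite (q.generators i).I ∧ Nat.card (q.generators i).I = Nat.card I := by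
  let e₀ := (nonempty_free_iso_over_of_iso_free e ⊤).some
  have hcov : (Opens.grothendieckTopology Y).CoversTop
      (fun _ : PUnit.{u + 1} => (⊤ : Y.Opens)) :=
    (Opens.coversTop_iff _ _).mpr (TopologicalSpace.IsOpenCover.mk
      (top_le_iff.mp fun y _ => Opens.mem_iSup.mpr ⟨PUnit.unit, trivial⟩))
  let q : SheafOfModules.LocalGeneratorsData (R := Y.ringCatSheaf) E :=
    { I := PUnit.{u + 1}
      X := fun _ => ⊤
      coversTop := hcov
      generators := fun _ => (SheafOfModules.free.generatingSections I).ofEpi e₀.hom }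
  have hq : ∀ _ : PUnit.{u + 1},
      IsIso ((SheafOfModules.free.generatingSections I).ofEpi e₀.hom).π := fun _ => by
    rw [SheafOfModules.GeneratingSections.ofEpi_π]
    infer_instance
  haveI hq' : q.IsLocallyFreeData :=
    SheafOfModules.LocalGeneratorsData.IsLocallyFreeData.mk (q := q) hq
  exact ⟨q, hq', fun _ => ⟨‹Finite I›, rfl⟩⟩

end Frames

/-! ### Exterior powers of a globally free module -/

section ExteriorFree

-- `TopCat.Presheaf`/`TopCat.Sheaf` are not reducible: as in Mathlib's `AlgebraicGeometry.Modules`.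
set_option backward.isDefEq.respectTransparency false

variable {Y : Scheme.{u}} {E N : Y.Modules} {I J : Type u} (n : ℕ)

/-- The restriction maps of the presheaf `U ↦ ⋀ⁿ Γ(E, U)` send the wedge basis vector
`b_S|_V = ∧_{i ∈ S} b_i|_V` of a compatible family of bases to `b_S|_{V'}`. [folklore] -/
theorem exteriorPowerPresheaf_map_basis [LinearOrder I]
    (b : ∀ V : Y.Opens, Module.Basis I Γ(Y, V) Γ(E, V))
    (hb : ∀ ⦃V V' : Y.Opens⦄ (l : V' ⟶ V) (i : I), E.presheaf.map l.op (b V i) = b V' i)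
    {V V' : Y.Opens} (l : op V ⟶ op V') (s : Set.powersetCard I n) :
    (exteriorPowerPresheaf E.val n).map l
        (((b V).exteriorPower n s : (exteriorPowerPresheaf E.val n).obj (op V))) =
      ((b V').exteriorPower n s : (exteriorPowerPresheaf E.val n).obj (op V')) := by
  rw [exteriorPower.basis_apply, exteriorPower.basis_apply, exteriorPower.ιMulti_family,
    exteriorPower.ιMulti_family]
  have hfun : (fun i => (E.val.map l (((b V) ∘ (Set.powersetCard.ofFinEmbEquiv.symm s)) i) :
      E.val.obj (op V'))) = (b V') ∘ (Set.powersetCard.ofFinEmbEquiv.symm s) :=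
    funext fun i => hb l.unop _
  refine (exteriorPowerPresheaf_map_mk E.val n l
    ((b V) ∘ (Set.powersetCard.ofFinEmbEquiv.symm s))).trans ?_
  exact congrArg ModuleCat.exteriorPower.mk hfun

/-- **`⋀ⁿ` of a presheaf of modules with compatible bases is free on the wedge bases**: given
compatible bases `b_V` (on `I`, linearly ordered) of the `Γ(E, V)` and compatible bases `c_V`
(on `J`) of the `Γ(N, V)`, and a bijection `ε : {S ⊆ I, #S = n} ≃ J`, the presheaf
`V ↦ ⋀ⁿ Γ(E, V)` is isomorphic to (the presheaf underlying) `N`, by `b_S ↦ c_{ε S}` objectwise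
(Mathlib's `Basis.exteriorPower`: `{b_S}` is a basis of `⋀ⁿ` of a free module). [folklore] -/
theorem nonempty_exteriorPowerPresheaf_iso_of_basis [LinearOrder I]
    (b : ∀ V : Y.Opens, Module.Basis I Γ(Y, V) Γ(E, V))
    (hb : ∀ ⦃V V' : Y.Opens⦄ (l : V' ⟶ V) (i : I), E.presheaf.map l.op (b V i) = b V' i)
    (c : ∀ V : Y.Opens, Module.Basis J Γ(Y, V) Γ(N, V))
    (hc : ∀ ⦃V V' : Y.Opens⦄ (l : V' ⟶ V) (j : J), N.presheaf.map l.op (c V j) = c V' j)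
    (ε : Set.powersetCard I n ≃ J) :
    Nonempty (exteriorPowerPresheaf E.val n ≅ N.val) := by
  -- the wedge bases, typed on the sections of the presheaf `⋀ⁿ E`
  let β : ∀ V : Y.Opens, Module.Basis (Set.powersetCard I n) Γ(Y, V)
      ((exteriorPowerPresheaf E.val n).obj (op V)) := fun V => (b V).exteriorPower n
  let γ : ∀ V : Y.Opens, Module.Basis J Γ(Y, V) (N.val.obj (op V)) := fun V => c V
  let φ : ∀ V : Y.Opens, (exteriorPowerPresheaf E.val n).obj (op V) ≅ N.val.obj (op V) :=
    fun V => ((β V).equiv (γ V) ε).toModuleIso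
  refine ⟨PresheafOfModules.isoMk (fun V => φ V.unop) ?_⟩
  rintro ⟨V⟩ ⟨V'⟩ l
  ext1
  refine (β V).ext fun s => ?_
  have h₁ : (exteriorPowerPresheaf E.val n).map l (β V s) = β V' s :=
    exteriorPowerPresheaf_map_basis n b hb l s
  have h₂ : N.val.map l (γ V (ε s)) = γ V' (ε s) := hc l.unop (ε s)
  have h₃ : ∀ (W : Y.Opens) (x : (exteriorPowerPresheaf E.val n).obj (op W)),
      (φ W).hom x = (β W).equiv (γ W) ε x := fun W x => rfl
  calc ((exteriorPowerPresheaf E.val n).map l ≫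
          (ModuleCat.restrictScalars _).map (φ V').hom).hom (β V s)
        = (φ V').hom ((exteriorPowerPresheaf E.val n).map l (β V s)) := rfl
    _ = (β V').equiv (γ V') ε (β V' s) := by rw [h₁, h₃]
    _ = γ V' (ε s) := Module.Basis.equiv_apply ..
    _ = N.val.map l ((β V).equiv (γ V) ε (β V s)) := by rw [Module.Basis.equiv_apply, h₂]
    _ = ((φ V).hom ≫ N.val.map l).hom (β V s) := rfl

/-- **Exterior powers of a globally free module of finite rank are globally free**: if
`E ≅ 𝒪_X^I` with `I` finite, then `⋀ⁿ E ≅ 𝒪_X^J` for any `J` in bijection with the `n`-element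
subsets of `I` (so `#J = C(#I, n)`). Proof: the presheaf `V ↦ ⋀ⁿ_{𝒪(V)} Γ(E, V)` is already
isomorphic to (the presheaf underlying) the sheaf `𝒪_X^J` (wedges of the global frame,
`nonempty_exteriorPowerPresheaf_iso_of_basis`), and `⋀ⁿ E` is its sheafification
(`sheafificationValIso`). (Hartshorne, *Algebraic Geometry*, II Ex. 5.16 (a): "if `ℱ` is locally
free of rank `n` then `⋀ʳ ℱ` is locally free of rank `C(n, r)`", in the globally free case, where
no localisation is needed.) [cite: Hartshorne1977, II Ex. 5.16(a)] -/
theorem nonempty_exteriorPowerSheaf_iso_free_of_equiv [Finite I]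
    (e : E ≅ SheafOfModules.free I) (ε : Set.powersetCard I n ≃ J) :
    Nonempty (exteriorPowerSheaf E n ≅ SheafOfModules.free (R := Y.ringCatSheaf) J) := by
  classical
  letI : LinearOrder I := linearOrderOfSTO WellOrderingRel
  haveI : Finite J := Finite.of_equiv _ ε
  obtain ⟨b, hb⟩ := exists_basis_sections_of_iso_free e
  obtain ⟨c, hc⟩ := exists_basis_sections_of_iso_free
    (Iso.refl (SheafOfModules.free (R := Y.ringCatSheaf) J : Y.Modules))
  obtain ⟨φ⟩ := nonempty_exteriorPowerPresheaf_iso_of_basis n b hb c hc ε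
  exact ⟨(PresheafOfModules.sheafification (𝟙 Y.ringCatSheaf.obj)).mapIso φ ≪≫
    sheafificationValIso _⟩

/-- `⋀ⁿ E ≅ 𝒪_X^{(n-subsets of I)}` for `E ≅ 𝒪_X^I`, `I` finite (the case
`J = {S ⊆ I, #S = n}` of `nonempty_exteriorPowerSheaf_iso_free_of_equiv`). [folklore] -/
theorem nonempty_exteriorPowerSheaf_iso_free [Finite I] (e : E ≅ SheafOfModules.free I) :
    Nonempty (exteriorPowerSheaf E n ≅
      SheafOfModules.free (R := Y.ringCatSheaf) (Set.powersetCard I n)) :=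
  nonempty_exteriorPowerSheaf_iso_free_of_equiv n e (Equiv.refl _)

/-- `⋀ⁿ E ≅ 𝒪_X^J` for `E ≅ 𝒪_X^I` with `I`, `J` finite and `#J = C(#I, n)` (cardinality form
of `nonempty_exteriorPowerSheaf_iso_free_of_equiv`; `#{S ⊆ I, #S = n} = C(#I, n)` is Mathlib's
`Set.powersetCard.card`). [folklore] -/
theorem nonempty_exteriorPowerSheaf_iso_free_of_card [Finite I] [Finite J]
    (e : E ≅ SheafOfModules.free I) (hJ : Nat.card J = (Nat.card I).choose n) :
    Nonempty (exteriorPowerSheaf E n ≅ SheafOfModules.free (R := Y.ringCatSheaf) J) :=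
  nonempty_exteriorPowerSheaf_iso_free_of_equiv n e
    ((Finite.equivFinOfCardEq (Set.powersetCard.card I n)).trans
      (Finite.equivFinOfCardEq hJ).symm)

end ExteriorFree

/-! ### The Hodge sheaves of a `k`-scheme with globally free cotangent sheaf -/

section Hodge

-- `TopCat.Presheaf`/`TopCat.Sheaf` are not reducible: as in Mathlib's `AlgebraicGeometry.Modules`.
set_option backward.isDefEq.respectTransparency false

variable {k : Type u} [CommRing k] (X : Over (Spec (CommRingCat.of k))) {I J : Type u}

/-- **`Ω¹_{X/k} ≅ 𝒪_X^I` gives `Ωᵃ_{X/k} ≅ 𝒪_X^J` for `J ≃ {S ⊆ I, #S = a}`** (`I` finite): the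
Hodge sheaf `Ωᵃ = ⋀ᵃ Ω¹` of a `k`-scheme with globally free cotangent sheaf is globally free, on
the wedges `ω_S = ω_{s₁} ∧ ⋯ ∧ ω_{s_a}` of a global coframe `(ω_i)_{i ∈ I}` (Hartshorne,
*Algebraic Geometry*, II Ex. 5.16 (a) in the globally free case; e.g. an abelian scheme, where
`Ω¹ ≅ 𝒪^g` on the invariant differentials). [cite: Hartshorne1977, II Ex. 5.16(a)] -/
theorem nonempty_hodgeSheaf_iso_free_of_equiv [Finite I]
    (e : cotangentSheaf X ≅ SheafOfModules.free I) (a : ℕ) (ε : Set.powersetCard I a ≃ J) :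
    Nonempty (hodgeSheaf X a ≅ SheafOfModules.free (R := X.left.ringCatSheaf) J) :=
  nonempty_exteriorPowerSheaf_iso_free_of_equiv a e ε

/-- `Ω¹_{X/k} ≅ 𝒪_X^I` (`I` finite) gives `Ωᵃ_{X/k} ≅ 𝒪_X^J` whenever `#J = C(#I, a)`.
[folklore] -/
theorem nonempty_hodgeSheaf_iso_free_of_card [Finite I] [Finite J]
    (e : cotangentSheaf X ≅ SheafOfModules.free I) (a : ℕ)
    (hJ : Nat.card J = (Nat.card I).choose a) :
    Nonempty (hodgeSheaf X a ≅ SheafOfModules.free (R := X.left.ringCatSheaf) J) :=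
  nonempty_exteriorPowerSheaf_iso_free_of_card a e hJ

/-- **The `Ω¹`-free branch**: if the cotangent sheaf of the `k`-scheme `X` is globally free on a
finite `I`, then every Hodge sheaf `Ωᵃ_{X/k}` is globally free on the `a`-element subsets of
`I`: `𝒪_X^{(a-subsets of I)} ≅ Ωᵃ_{X/k}`. [folklore] -/
theorem nonempty_free_iso_hodgeSheaf_of_cotangentSheaf_free [Finite I]
    (h : Nonempty (cotangentSheaf X ≅ SheafOfModules.free I)) (a : ℕ) :
    Nonempty (SheafOfModules.free (R := X.left.ringCatSheaf) (Set.powersetCard I a) ≅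
      hodgeSheaf X a) := by
  obtain ⟨e⟩ := h
  obtain ⟨f⟩ := nonempty_hodgeSheaf_iso_free_of_equiv X e a (Equiv.refl _)
  exact ⟨f.symm⟩

/-- `#{S ⊆ Fin d, #S = a} = C(d, a)` (Mathlib's `Set.powersetCard.card` with
`Nat.card (Fin d) = d`). [folklore] -/
theorem natCard_powersetCard_fin (d a : ℕ) :
    Nat.card (Set.powersetCard (Fin d) a) = d.choose a := by
  rw [Set.powersetCard.card, Nat.card_eq_fintype_card, Fintype.card_fin]

/-- **The `Ω¹`-free branch, `Fin`-indexed form** (universe `0`, the form "`Ω¹_{𝒳/W} ≅ 𝒪^d`" in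
which the hypothesis is stated for the `p`-adic lifting route): `Ω¹_{X/k} ≅ 𝒪_X^d` gives
`Ωᵃ_{X/k} ≅ 𝒪_X^{C(d,a)}` for every `a`. [folklore] -/
theorem nonempty_hodgeSheaf_iso_free_fin {k : Type} [CommRing k]
    (X : Over (Spec (CommRingCat.of k))) {d : ℕ}
    (h : Nonempty (cotangentSheaf X ≅ SheafOfModules.free (Fin d))) (a : ℕ) :
    Nonempty (hodgeSheaf X a ≅
      SheafOfModules.free (R := X.left.ringCatSheaf) (Fin (d.choose a))) := by
  obtain ⟨e⟩ := h
  exact nonempty_hodgeSheaf_iso_free_of_equiv X e a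
    (Finite.equivFinOfCardEq (natCard_powersetCard_fin d a))

/-- **The `Ω¹`-free branch, `Fin`-indexed form**: `Ω¹_{X/k} ≅ 𝒪_X^d` gives
`𝒪_X^{C(d,a)} ≅ Ωᵃ_{X/k}` for every `a` (universe `0`). [folklore] -/
theorem nonempty_free_fin_iso_hodgeSheaf_of_cotangentSheaf_free {k : Type} [CommRing k]
    (X : Over (Spec (CommRingCat.of k))) {d : ℕ}
    (h : Nonempty (cotangentSheaf X ≅ SheafOfModules.free (Fin d))) (a : ℕ) :
    Nonempty (SheafOfModules.free (R := X.left.ringCatSheaf) (Fin (d.choose a)) ≅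
      hodgeSheaf X a) := by
  obtain ⟨f⟩ := nonempty_hodgeSheaf_iso_free_fin X h a
  exact ⟨f.symm⟩

/-- On the `Ω¹`-free branch the abelian sheaves underlying `Ωᵃ_{X/k}` and `𝒪_X^J`
(`#J = C(#I, a)`) are isomorphic (the functor `SheafOfModules.toSheaf` applied to
`nonempty_hodgeSheaf_iso_free_of_card`); this is the form in which
`Hᵇ(X, Ωᵃ) = Hᵇ(toSheaf Ωᵃ)` (`Motives.hodgeCohomology`) is compared with `Hᵇ(X, 𝒪)^{C(#I,a)}`.
[folklore] -/
theorem nonempty_toSheaf_hodgeSheaf_iso_of_card [Finite I] [Finite J]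
    (e : cotangentSheaf X ≅ SheafOfModules.free I) (a : ℕ)
    (hJ : Nat.card J = (Nat.card I).choose a) :
    Nonempty ((SheafOfModules.toSheaf X.left.ringCatSheaf).obj (hodgeSheaf X a) ≅
      (SheafOfModules.toSheaf X.left.ringCatSheaf).obj (SheafOfModules.free J)) := by
  obtain ⟨f⟩ := nonempty_hodgeSheaf_iso_free_of_card X e a hJ
  exact ⟨(SheafOfModules.toSheaf X.left.ringCatSheaf).mapIso f⟩

/-- On the `Ω¹`-free branch every Hodge sheaf `Ωᵃ_{X/k}` is finite locally free
(`Motives.IsFiniteLocallyFree`), with no smoothness hypothesis. [folklore] -/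
theorem isFiniteLocallyFree_hodgeSheaf_of_cotangentSheaf_free [Finite I]
    (h : Nonempty (cotangentSheaf X ≅ SheafOfModules.free I)) (a : ℕ) :
    IsFiniteLocallyFree (hodgeSheaf X a) := by
  obtain ⟨e⟩ := h
  obtain ⟨f⟩ := nonempty_hodgeSheaf_iso_free_of_equiv X e a (Equiv.refl _)
  exact isFiniteLocallyFree_of_iso_free f

-- the sheafification instances on the over-sites behind `LocalGeneratorsData` sit at the default
-- synthesis budget's edge here (as for `exists_isLocallyFreeData_of_iso_free`)
set_option synthInstance.maxHeartbeats 160000 in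
/-- On the `Ω¹`-free branch (`Ω¹_{X/k} ≅ 𝒪_X^I`, `I` finite) the Hodge sheaf `Ωᵃ_{X/k}` has
constant rank `C(#I, a)`: local generators data which are locally free data with `C(#I, a)`
generators on each member of the cover — the shape of
`Motives.HasRank (hodgeSheaf X a) ((Nat.card I).choose a)` and of
`Motives.hasRank_hodgeSheaf_choose`, here WITHOUT any smoothness hypothesis. [folklore] -/
theorem exists_isLocallyFreeData_hodgeSheaf_of_cotangentSheaf_free [Finite I]
    (h : Nonempty (cotangentSheaf X ≅ SheafOfModules.free I)) (a : ℕ) :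
    ∃ q : SheafOfModules.LocalGeneratorsData.{u} (R := X.left.ringCatSheaf) (hodgeSheaf X a),
      q.IsLocallyFreeData ∧
        ∀ i, Finite (q.generators i).I ∧ Nat.card (q.generators i).I = (Nat.card I).choose a := by
  let f := (nonempty_hodgeSheaf_iso_free_of_equiv X h.some a (Equiv.refl _)).some
  have hf := exists_isLocallyFreeData_of_iso_free f
  exact hf.imp fun q hq =>
    ⟨hq.1, fun i => ⟨(hq.2 i).1, (hq.2 i).2.trans (Set.powersetCard.card I a)⟩⟩

end Hodge

end Literature.AlgebraicGeometry.Motives
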